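import Literature.NumberTheory.DiophantineApproximation.PolylogTwoPointHermitePade
import Literature.NumberTheory.DiophantineApproximation.DilogHermitePadeSeries
import HarnessLib

/-!
# The parity Hermite–Padé form at `y = 1/M` as `∑_{o<w} (a_o Li_{o+1}(1/M) + b_o Θ_{o+1}(1/M)) + a`

Topic `Literature/NumberTheory/DiophantineApproximation`. For the weight-`w` PARITY form
`Λ^{(w)}_n(y) = ∑_{u ≥ 0} K^{(w)}_n(u) y^{u+1}` of `PolylogTwoPointHermitePade.lean`
(`ParityPade.formH`), a partial fraction expansion of the kernel at the naturals in the doubled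
variable `t = 2u`, `K^{(w)}_n(u) = ∑_{p ≤ n} ∑_{o<w} c_{o,p}/(2u+p+1)^{o+1}`
(`BallRivoal.pfEval n w c (2u)`; proved to exist in the sibling file
`PolylogTwoPointHermitePadeExpansion.lean`, here it is the HYPOTHESIS `hc`), turns
`2^w Λ^{(w)}_n(1/M)` into `∑_{o<w} (a_o L_{o+1} + b_o Θ_{o+1}) + a`, where
`L_s = ∑_{k ≥ 1} M^{-k}/k^s` (`DilogPade.polylogSeries s (1/M)`),
`Θ_s = ∑_{k ≥ 0} M^{-k-1}/(2k+1)^s` (`ParityPade.oddPolylogSeries s (1/M)`),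
`a_o = coefLi n w c M o` (odd pole indices `p`), `b_o = coefTh n w c M o` (even `p`) and
`a = constH n w c M`.

* `summable_pow_div_oddShift`, `summable_oddPolylogSeries` — the series
  `∑_u y^{u+1}/(2(u+i)+1)^s` converge for `0 ≤ y < 1` (comparison with the geometric series);
* `pow_mul_tsum_oddShift` — `y^i ∑_{u ≥ 0} y^{u+1}/(2(u+i)+1)^s = Θ_s(y) − ∑_{k<i} y^{k+1}/(2k+1)^s`;
* `formH_eq_of_pfEval` — `2^w Λ^{(w)}_n(1/M) = ∑_{o<w} (coefLi n w c M o) L_{o+1}(1/M)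
  + ∑_{o<w} (coefTh n w c M o) Θ_{o+1}(1/M) + constH n w c M` for `M ≥ 2`
  (the parity analogue of `PolylogPade.formW_eq_of_pfEval`).

The computation, per pole index `p ≤ n` and order `s = o + 1`: for ODD `p = 2i+1` the denominator is
even, `2u + p + 1 = 2(u+1+i)`, so `2^w ∑_u y^{u+1}/(2u+p+1)^s = 2^{w−s} M^i (L_s − ∑_{k<i} y^{k+1}/(k+1)^s)`
at `y = 1/M` (`DilogPade.pow_mul_tsum_shift`, `y^i M^i = 1`); for EVEN `p = 2i` it is odd,
`2u + p + 1 = 2(u+i) + 1`, so `∑_u y^{u+1}/(2u+p+1)^s = M^i (Θ_s − ∑_{k<i} y^{k+1}/(2k+1)^s)`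
(`pow_mul_tsum_oddShift`); in both finite remainders `M^i y^{k+1} = M^i/M^{k+1}` and `i = p/2`
(natural division).

References: S. David, N. Hirata-Kohno, M. Kawashima, *Can polylogarithms at algebraic points be
linearly independent?*, Moscow J. Comb. Number Th. 9 (2020), Thm 2.1; M. Hata, *On the linear
independence of the values of polylogarithmic functions*, J. Math. Pures Appl. 69 (1990);
E. M. Nikišin, Mat. Sb. 109 (1979). Everything here is PROVED from Mathlib's `tsum` API and
`DilogHermitePadeSeries.lean`; no definitions, no named facts.
-/

noncomputable section

open Finset

namespace Literature.NumberTheory.DiophantineApproximation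

namespace ParityPade

open Literature.NumberTheory.Transcendental

/-- Summability of the odd-shifted series `∑_u y^{u+1}/(2(u+i)+1)^s` for `0 ≤ y < 1`: its terms are
nonnegative and at most `y^{u+1}` (the denominators are `≥ 1`), so it is dominated by the geometric
series. [folklore] -/
theorem summable_pow_div_oddShift (s i : ℕ) {y : ℝ} (hy : 0 ≤ y) (hy1 : y < 1) :
    Summable fun u : ℕ => y ^ (u + 1) / (2 * ((u : ℝ) + i) + 1) ^ s := by
  refine Summable.of_nonneg_of_le (fun u => by positivity) (fun u => ?_)
    ((summable_geometric_of_lt_one hy hy1).mul_left y)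
  rw [← pow_succ']
  exact div_le_self (pow_nonneg hy _) (one_le_pow₀ (le_add_of_nonneg_left (by positivity)))

/-- Summability of the odd polylogarithm-type series `∑_k y^{k+1}/(2k+1)^s` (the series defining
`oddPolylogSeries s y = Θ_s(y)`) for `0 ≤ y < 1`, by comparison with the geometric series.
[folklore] -/
theorem summable_oddPolylogSeries (s : ℕ) {y : ℝ} (hy : 0 ≤ y) (hy1 : y < 1) :
    Summable fun k : ℕ => y ^ (k + 1) / (2 * (k : ℝ) + 1) ^ s := by
  simpa using summable_pow_div_oddShift s 0 hy hy1

/-- The odd-shifted series: for `0 ≤ y < 1` and `i, s ∈ ℕ`,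
`y^i · ∑_{u ≥ 0} y^{u+1}/(2(u+i)+1)^s = Θ_s(y) − ∑_{k<i} y^{k+1}/(2k+1)^s`
(reindex `k = u + i` in `Θ_s(y) = ∑_{k ≥ 0} y^{k+1}/(2k+1)^s`). [folklore] -/
theorem pow_mul_tsum_oddShift (s i : ℕ) {y : ℝ} (hy : 0 ≤ y) (hy1 : y < 1) :
    y ^ i * ∑' u : ℕ, y ^ (u + 1) / (2 * ((u : ℝ) + i) + 1) ^ s =
      oddPolylogSeries s y - ∑ k ∈ Finset.range i, y ^ (k + 1) / (2 * (k : ℝ) + 1) ^ s := by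
  rw [oddPolylogSeries, ← (summable_oddPolylogSeries s hy hy1).sum_add_tsum_nat_add i,
    add_sub_cancel_left, ← tsum_mul_left]
  refine tsum_congr fun u => ?_
  push_cast
  ring

/-- **The weight-`w` parity Hermite–Padé form at `y = 1/M`** (David–Hirata-Kohno–Kawashima 2020,
the computation behind Thm 2.1 at the two points `±1/N`, `M = N²`; Hata 1990; Nikišin 1979). If the
parity kernel has the partial fraction expansion
`K^{(w)}_n(u) = ∑_{p ≤ n} ∑_{o<w} c_{o,p}/(2u+p+1)^{o+1}` at the naturals `u`
(`BallRivoal.pfEval n w c (2u)`), then for every integer `M ≥ 2`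
`2^w Λ^{(w)}_n(1/M) = ∑_{o<w} a_o · L_{o+1}(1/M) + ∑_{o<w} b_o · Θ_{o+1}(1/M) + a`
with `a_o = coefLi n w c M o` (odd pole indices), `b_o = coefTh n w c M o` (even pole indices),
`a = constH n w c M`, `L_s = DilogPade.polylogSeries s` and `Θ_s = oddPolylogSeries s`.
[cite: DavidHirataKohnoKawashima2020, Thm 2.1] -/
theorem formH_eq_of_pfEval {w n M : ℕ} (hM : 2 ≤ M) (c : ℕ → ℕ → ℚ)
    (hc : ∀ u : ℕ, kernelH w n u = BallRivoal.pfEval n w c (2 * u)) :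
    (2 : ℝ) ^ w * formH w n (1 / (M : ℝ)) =
      (∑ o ∈ Finset.range w,
          ((coefLi n w c M o : ℚ) : ℝ) * DilogPade.polylogSeries (o + 1) (1 / (M : ℝ))) +
      (∑ o ∈ Finset.range w,
          ((coefTh n w c M o : ℚ) : ℝ) * oddPolylogSeries (o + 1) (1 / (M : ℝ))) +
        ((constH n w c M : ℚ) : ℝ) := by
  have hMpos : (0 : ℝ) < M := Nat.cast_pos.mpr (by omega)
  have hM0 : (M : ℝ) ≠ 0 := hMpos.ne'
  set y : ℝ := 1 / (M : ℝ) with hy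
  have hy0 : 0 ≤ y := by positivity
  have hy1 : y < 1 := by
    rw [hy, div_lt_one hMpos]
    exact_mod_cast (by omega : 1 < M)
  have hMy : ∀ j : ℕ, (M : ℝ) ^ j * y ^ j = 1 := fun j => by
    rw [← mul_pow, hy, mul_one_div_cancel hM0, one_pow]
  -- summability of the general term `y^{u+1}/(2u+p+1)^s` (comparison with the geometric series)
  have hS : ∀ s p : ℕ, Summable fun u : ℕ => y ^ (u + 1) / (2 * (u : ℝ) + p + 1) ^ s := by
    intro s p
    refine Summable.of_nonneg_of_le (fun u => by positivity) (fun u => ?_)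
      ((summable_geometric_of_lt_one hy0 hy1).mul_left y)
    rw [← pow_succ']
    exact div_le_self (pow_nonneg hy0 _) (one_le_pow₀ (le_add_of_nonneg_left (by positivity)))
  -- the two shift identities at `y = 1/M`, solved for the shifted series:
  -- odd pole index `p = 2i+1` (even denominators `2(u+1+i)`, the `Li` series) ...
  have hgOdd : ∀ s i : ℕ,
      (2 : ℝ) ^ s * ∑' u : ℕ, y ^ (u + 1) / (2 * (u : ℝ) + ((2 * i + 1 : ℕ) : ℝ) + 1) ^ s =
        (M : ℝ) ^ i * (DilogPade.polylogSeries s y -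
          ∑ k ∈ range i, y ^ (k + 1) / ((k : ℝ) + 1) ^ s) := by
    intro s i
    rw [← DilogPade.pow_mul_tsum_shift s i hy0 hy1, ← mul_assoc, hMy, one_mul, ← tsum_mul_left]
    refine tsum_congr fun u => ?_
    rw [show (2 * (u : ℝ) + ((2 * i + 1 : ℕ) : ℝ) + 1) = 2 * ((u : ℝ) + 1 + i) by push_cast; ring,
      mul_pow, mul_div_assoc', mul_div_mul_left _ _ (pow_ne_zero s two_ne_zero)]
  -- ... and even pole index `p = 2i` (odd denominators `2(u+i)+1`, the `Θ` series).
  have hgEven : ∀ s i : ℕ,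
      ∑' u : ℕ, y ^ (u + 1) / (2 * (u : ℝ) + ((2 * i : ℕ) : ℝ) + 1) ^ s =
        (M : ℝ) ^ i * (oddPolylogSeries s y -
          ∑ k ∈ range i, y ^ (k + 1) / (2 * (k : ℝ) + 1) ^ s) := by
    intro s i
    rw [← pow_mul_tsum_oddShift s i hy0 hy1, ← mul_assoc, hMy, one_mul]
    refine tsum_congr fun u => ?_
    rw [show (2 * (u : ℝ) + ((2 * i : ℕ) : ℝ) + 1) = 2 * ((u : ℝ) + i) + 1 by push_cast; ring]
  -- Step 1: expand the kernel by `hc` (cast from `ℚ` to `ℝ`) and exchange `tsum` and finite sums.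
  have hterm : ∀ u : ℕ, (kernelH w n u : ℝ) * y ^ (u + 1) =
      ∑ p ∈ range (n + 1), ∑ o ∈ range w,
        (c o p : ℝ) * (y ^ (u + 1) / (2 * (u : ℝ) + p + 1) ^ (o + 1)) := by
    intro u
    have hcu : (kernelH w n u : ℝ) =
        ∑ p ∈ range (n + 1), ∑ o ∈ range w, (c o p : ℝ) / (2 * (u : ℝ) + p + 1) ^ (o + 1) := by
      rw [hc u]
      push_cast [BallRivoal.pfEval]
      rfl
    rw [hcu, Finset.sum_mul]
    refine Finset.sum_congr rfl fun p _ => ?_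
    rw [Finset.sum_mul]
    refine Finset.sum_congr rfl fun o _ => ?_
    ring
  have h1 : formH w n y = ∑ p ∈ range (n + 1), ∑ o ∈ range w,
      (c o p : ℝ) * ∑' u : ℕ, y ^ (u + 1) / (2 * (u : ℝ) + p + 1) ^ (o + 1) := by
    rw [formH, tsum_congr hterm, Summable.tsum_finsetSum fun p _ =>
      summable_sum fun o _ => (hS (o + 1) p).mul_left (c o p : ℝ)]
    refine Finset.sum_congr rfl fun p _ => ?_
    rw [Summable.tsum_finsetSum fun o _ => (hS (o + 1) p).mul_left (c o p : ℝ)]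
    refine Finset.sum_congr rfl fun o _ => ?_
    exact tsum_mul_left
  -- Step 2: per pole index `p` and order `o + 1`, insert the shift identity of the right parity
  -- and evaluate the finite remainder at `y = 1/M` (`M^i y^{k+1} = M^i/M^{k+1}`, `i = p/2`).
  have h2 : (2 : ℝ) ^ w * formH w n y = ∑ p ∈ range (n + 1), ∑ o ∈ range w,
      (((if Odd p then c o p * 2 ^ (w - 1 - o) * (M : ℚ) ^ (p / 2) else 0 : ℚ) : ℝ) *
          DilogPade.polylogSeries (o + 1) y +
        ((if Even p then c o p * 2 ^ w * (M : ℚ) ^ (p / 2) else 0 : ℚ) : ℝ) *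
          oddPolylogSeries (o + 1) y -
        ((c o p *
          (if Odd p then
            (2 : ℚ) ^ (w - 1 - o) *
              ∑ k ∈ range (p / 2), (M : ℚ) ^ (p / 2) / ((M : ℚ) ^ (k + 1) * ((k : ℚ) + 1) ^ (o + 1))
           else
            (2 : ℚ) ^ w *
              ∑ k ∈ range (p / 2),
                (M : ℚ) ^ (p / 2) / ((M : ℚ) ^ (k + 1) * (2 * (k : ℚ) + 1) ^ (o + 1))) : ℚ) : ℝ)) := by
    rw [h1, Finset.mul_sum]
    refine Finset.sum_congr rfl fun p _ => ?_
    rw [Finset.mul_sum]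
    refine Finset.sum_congr rfl fun o ho => ?_
    replace ho : o < w := Finset.mem_range.mp ho
    obtain ⟨i, rfl | rfl⟩ := Nat.even_or_odd' p
    · -- even pole index `p = 2i`: the `Θ` series
      have hi : 2 * i / 2 = i := by omega
      have hev : Even (2 * i) := even_two_mul i
      have hnodd : ¬Odd (2 * i) := Nat.not_odd_iff_even.mpr hev
      have hfin : (M : ℝ) ^ i * ∑ k ∈ range i, y ^ (k + 1) / (2 * (k : ℝ) + 1) ^ (o + 1) =
          ∑ k ∈ range i, (M : ℝ) ^ i / ((M : ℝ) ^ (k + 1) * (2 * (k : ℝ) + 1) ^ (o + 1)) := by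
        rw [Finset.mul_sum]
        refine Finset.sum_congr rfl fun k _ => ?_
        rw [hy, one_div_pow, div_div, mul_one_div]
      rw [hgEven (o + 1) i]
      simp only [if_neg hnodd, if_pos hev, hi]
      push_cast
      rw [← hfin]
      ring
    · -- odd pole index `p = 2i+1`: the `Li` series, `2^w = 2^{w-1-o} · 2^{o+1}`
      have hi : (2 * i + 1) / 2 = i := by omega
      have hodd : Odd (2 * i + 1) := odd_two_mul_add_one i
      have hnev : ¬Even (2 * i + 1) := Nat.not_even_iff_odd.mpr hodd
      have hfin : (M : ℝ) ^ i * ∑ k ∈ range i, y ^ (k + 1) / ((k : ℝ) + 1) ^ (o + 1) =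
          ∑ k ∈ range i, (M : ℝ) ^ i / ((M : ℝ) ^ (k + 1) * ((k : ℝ) + 1) ^ (o + 1)) := by
        rw [Finset.mul_sum]
        refine Finset.sum_congr rfl fun k _ => ?_
        rw [hy, one_div_pow, div_div, mul_one_div]
      have h2w : (2 : ℝ) ^ w = 2 ^ (w - 1 - o) * 2 ^ (o + 1) := by
        rw [← pow_add]
        congr 1
        omega
      rw [h2w, mul_assoc, mul_left_comm ((2 : ℝ) ^ (o + 1)), hgOdd (o + 1) i]
      simp only [if_pos hodd, if_neg hnev, hi]
      push_cast
      rw [← hfin]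
      ring
  -- Step 3: swap the two finite sums and identify the coefficients.
  have hA : ∀ o : ℕ, ((coefLi n w c M o : ℚ) : ℝ) * DilogPade.polylogSeries (o + 1) y =
      ∑ p ∈ range (n + 1),
        ((if Odd p then c o p * 2 ^ (w - 1 - o) * (M : ℚ) ^ (p / 2) else 0 : ℚ) : ℝ) *
          DilogPade.polylogSeries (o + 1) y := by
    intro o
    rw [coefLi, Rat.cast_sum, Finset.sum_mul]
  have hB : ∀ o : ℕ, ((coefTh n w c M o : ℚ) : ℝ) * oddPolylogSeries (o + 1) y =
      ∑ p ∈ range (n + 1),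
        ((if Even p then c o p * 2 ^ w * (M : ℚ) ^ (p / 2) else 0 : ℚ) : ℝ) *
          oddPolylogSeries (o + 1) y := by
    intro o
    rw [coefTh, Rat.cast_sum, Finset.sum_mul]
  have hC : ((constH n w c M : ℚ) : ℝ) = -∑ o ∈ range w, ∑ p ∈ range (n + 1),
      ((c o p *
        (if Odd p then
          (2 : ℚ) ^ (w - 1 - o) *
            ∑ k ∈ range (p / 2), (M : ℚ) ^ (p / 2) / ((M : ℚ) ^ (k + 1) * ((k : ℚ) + 1) ^ (o + 1))
         else
          (2 : ℚ) ^ w *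
            ∑ k ∈ range (p / 2),
              (M : ℚ) ^ (p / 2) / ((M : ℚ) ^ (k + 1) * (2 * (k : ℚ) + 1) ^ (o + 1))) : ℚ) : ℝ) := by
    simp only [constH, Rat.cast_neg, Rat.cast_sum]
  rw [h2, Finset.sum_comm]
  simp only [Finset.sum_sub_distrib, Finset.sum_add_distrib]
  simp_rw [hA, hB]
  rw [hC]
  ring

end ParityPade

end Literature.NumberTheory.DiophantineApproximation
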